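import Summits.CriticalPhenomena.PercolationContinuityZ3.Theorems.PercNearOneGluingNoHeavyQuantFarSunLargeKCentral
import HarnessLib

/-!
# FAR beyond trees: tools for the SHARP boost of a central position at every layer — witness count `#wit ≤ #Q − 2j`,
# count pmf above a threshold (Chernoff tail with free `θ`, mass, first moment), Cauchy–Schwarz flank efficiency

builds on p205010 (kernel theorem, internal audit signed; external expert review pending)

Support file (`--supports stmt-CriticalPhenomena-4575`), seat `prim-cert-1` (gen 42); memo `prim-cert-1/FROM-prim-cert-1-g42-SHARP-LARGEK.md`.
Layer `j ≥ 1`.  First half of the per-position analysis behind the sharpened all-layer large-`K` theorem (`…QuantFarSunSharpBoost`,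
`…QuantFarSunSharpLargeK`), replacing the crude factors of `…QuantFarSunLargeKCentral` (kernel mass `1/#wit ≥ 1/K`, flank probability `≥ 1/2`):

* `HairyCycle.card_wit_add_le` — a pattern with a witness has `#wit + 2j ≤ #Q` (the `j` least and the `j` largest members are never witnesses;
  rank injection), so opening a flanked hair `k` on `Q ∌ k` gives it kernel mass `≥ 1/(A + B + 1 − 2j)` (`A`, `B` the open counts on the two sides);
* `HairyCycle.countTail_le_chernoff` / `sum_countMass_ge_gen` / `sum_countMass_mul_le_mean_gen` — Chernoff lower tail of an open count with free
  `θ ∈ (0,1]` (`P(#(Q∩C) ≤ c) ≤ e^{−(1−θ)M}/θ^c` when the mass of `C` is `≥ M`), mass and first moment of the count pmf above a threshold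
  (generalising `…QuantFarSunAvgCentral`, which has threshold `2` and `θ = 1/3`);
* `HairyCycle.flank_sum_lower_bound_gen` — Cauchy–Schwarz (Sedrakyan) for `Σ_{a,b ≥ j} p_a q_b/(a+b+1−2j)`;
* `HairyCycle.flank_algebra_gen` — the algebra `ρ³ ≤ X·(Σ − (2j−1)ρ)` from it when both flank probabilities are `≥ ρ > 0`, the first moments above
  `j` are `≤ Σ_L − jπ_L`, `Σ_R − jπ_R`, and `Σ_L + Σ_R ≤ Σ`.
No definitions, no sorries, standard axioms.  Elementary [this work].
-/

noncomputable section

namespace Summit.CriticalPhenomena.PercolationContinuityZ3.Theorems.HairyCycle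

open Finset
open scoped Classical

variable {K : ℕ}

/-! ## A pattern with a witness has at least `#wit + 2j` members -/

/-- Splitting a pattern at a member: `#{e ∈ Q : e < d} + #{e ∈ Q : d < e} + 1 = #Q` for `d ∈ Q`. [this work] -/
theorem card_filter_lt_add_card_filter_gt {Q : Finset ℕ} {d : ℕ} (hdQ : d ∈ Q) :
    (Q.filter fun e => e < d).card + (Q.filter fun e => d < e).card + 1 = Q.card := by
  have h1 : Q = (Q.filter fun e => e < d) ∪ ((Q.filter fun e => d < e) ∪ {d}) := by
    ext e
    simp only [Finset.mem_union, Finset.mem_filter, Finset.mem_singleton]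
    constructor
    · intro he
      rcases lt_trichotomy e d with h | h | h
      · exact Or.inl ⟨he, h⟩
      · exact Or.inr (Or.inr h)
      · exact Or.inr (Or.inl ⟨he, h⟩)
    · rintro (⟨he, _⟩ | ⟨he, _⟩ | rfl)
      · exact he
      · exact he
      · exact hdQ
  have hdisj1 : Disjoint (Q.filter fun e => e < d) ((Q.filter fun e => d < e) ∪ {d}) := by
    rw [Finset.disjoint_left]
    intro e he he'
    rw [Finset.mem_filter] at he
    rw [Finset.mem_union, Finset.mem_filter, Finset.mem_singleton] at he'
    rcases he' with ⟨_, h⟩ | h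
    · exact lt_asymm he.2 h
    · exact absurd he.2 (h ▸ lt_irrefl e)
  have hdisj2 : Disjoint (Q.filter fun e => d < e) ({d} : Finset ℕ) := by
    rw [Finset.disjoint_singleton_right, Finset.mem_filter]
    exact fun h => lt_irrefl d h.2
  conv_rhs => rw [h1]
  rw [Finset.card_union_of_disjoint hdisj1, Finset.card_union_of_disjoint hdisj2, Finset.card_singleton]
  omega

/-- **`#wit + 2j ≤ #Q`** for a pattern `Q` with a witness (layer `j`): the rank `d ↦ #{e ∈ Q : e < d}` maps the witness set injectively
into `[j, #Q − 1 − j]`. [this work] -/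
theorem card_wit_add_le {j : ℕ} {Q : Finset ℕ} (hQ : (wit j Q).Nonempty) : (wit j Q).card + 2 * j ≤ Q.card := by
  have hQ1 : 2 * j + 1 ≤ Q.card := by
    obtain ⟨d, hd⟩ := hQ
    obtain ⟨hdQ, hb, ha⟩ := Finset.mem_filter.1 hd
    have := card_filter_lt_add_card_filter_gt hdQ
    omega
  set r : ℕ → ℕ := fun d => (Q.filter fun e => e < d).card with hr
  have hmaps : Set.MapsTo r (wit j Q : Set ℕ) (Icc j (Q.card - 1 - j) : Set ℕ) := by
    intro d hd
    rw [Finset.mem_coe] at hd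
    obtain ⟨hdQ, hb, ha⟩ := Finset.mem_filter.1 hd
    have hs := card_filter_lt_add_card_filter_gt hdQ
    rw [Finset.mem_coe, Finset.mem_Icc]
    refine ⟨hb, ?_⟩
    change (Q.filter fun e => e < d).card ≤ Q.card - 1 - j
    omega
  -- the rank is strictly increasing on `Q`
  have hmono : ∀ d ∈ Q, ∀ d' ∈ Q, d < d' → r d < r d' := by
    intro d hd d' hd' hlt
    apply Finset.card_lt_card
    rw [Finset.ssubset_def]
    refine ⟨fun e he => ?_, fun hsup => ?_⟩
    · rw [Finset.mem_filter] at he ⊢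
      exact ⟨he.1, lt_trans he.2 hlt⟩
    · have hmem : d ∈ Q.filter fun e => e < d' := Finset.mem_filter.2 ⟨hd, hlt⟩
      have := hsup hmem
      rw [Finset.mem_filter] at this
      exact lt_irrefl d this.2
  have hinj : Set.InjOn r (wit j Q : Set ℕ) := by
    intro d hd d' hd' hrr
    rw [Finset.mem_coe] at hd hd'
    have hdQ := mem_of_mem_wit hd
    have hd'Q := mem_of_mem_wit hd'
    by_contra hne
    rcases lt_or_gt_of_ne hne with hlt | hgt
    · have := hmono d hdQ d' hd'Q hlt
      omega
    · have := hmono d' hd'Q d hdQ hgt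
      omega
  have hcard := Finset.card_le_card_of_injOn r hmaps hinj
  rw [Nat.card_Icc] at hcard
  omega

/-! ## Count pmf above a threshold: Chernoff tail, mass, first moment -/

/-- **Chernoff lower tail with free `θ`**: for `0 < θ ≤ 1`, `0 ≤ h ≤ 1` on `range K` and an index set `C` of hair mass `≥ M`
(`M ≤ Σ_{k<K, k∈C} h k`):  `P(#(Q∩C) ≤ c) = Σ_Q hairW K h Q·𝟙[#(Q∩C) ≤ c] ≤ e^{−(1−θ)M}/θ^c`. [this work] -/
theorem countTail_le_chernoff {h : ℕ → ℝ} (hh : ∀ k, k < K → 0 ≤ h k ∧ h k ≤ 1) (C : Finset ℕ) (c : ℕ)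
    {θ M : ℝ} (hθ0 : 0 < θ) (hθ1 : θ ≤ 1) (hM : M ≤ ∑ k ∈ (range K).filter (fun k => k ∈ C), h k) :
    ∑ Q ∈ (range K).powerset, hairW K h Q * (if (Q ∩ C).card ≤ c then (1 : ℝ) else 0) ≤ Real.exp (-(1 - θ) * M) / θ ^ c := by
  have hc := pow_mul_sum_hairW_count_le_exp hh C c hθ0 hθ1
  have h1 : Real.exp (-(1 - θ) * ∑ k ∈ (range K).filter (fun k => k ∈ C), h k) ≤ Real.exp (-(1 - θ) * M) :=
    Real.exp_le_exp.2 (by nlinarith)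
  have hθc : 0 < θ ^ c := pow_pos hθ0 c
  rw [le_div_iff₀ hθc, mul_comm]
  exact hc.trans h1

/-- Mass of the count pmf at `≥ c+1` is one minus the mass at `≤ c`. [this work] -/
theorem sum_countMass_ge_gen (h : ℕ → ℝ) (C : Finset ℕ) (c : ℕ) :
    ∑ a ∈ (range (K + 1)).filter (fun a => c + 1 ≤ a), ∑ Q ∈ (range K).powerset, hairW K h Q * (if (Q ∩ C).card = a then (1 : ℝ) else 0) =
      1 - ∑ Q ∈ (range K).powerset, hairW K h Q * (if (Q ∩ C).card ≤ c then (1 : ℝ) else 0) := by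
  have htot := sum_countMass_eq_one (K := K) h C
  rw [← Finset.sum_filter_add_sum_filter_not (range (K + 1)) (fun a => c + 1 ≤ a)] at htot
  have hlow : ∑ a ∈ (range (K + 1)).filter (fun a => ¬ c + 1 ≤ a), ∑ Q ∈ (range K).powerset, hairW K h Q * (if (Q ∩ C).card = a then (1 : ℝ) else 0) =
      ∑ Q ∈ (range K).powerset, hairW K h Q * (if (Q ∩ C).card ≤ c then (1 : ℝ) else 0) := by
    rw [Finset.sum_comm]
    refine Finset.sum_congr rfl fun Q hQ => ?_
    rw [Finset.mem_powerset] at hQ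
    rw [← Finset.mul_sum]
    congr 1
    have hcard : (Q ∩ C).card ≤ K :=
      (Finset.card_le_card (Finset.inter_subset_left (s₁ := Q) (s₂ := C))).trans
        ((Finset.card_le_card hQ).trans (Finset.card_range K).le)
    by_cases h1 : (Q ∩ C).card ≤ c
    · rw [if_pos h1]
      have hmem : (Q ∩ C).card ∈ (range (K + 1)).filter (fun a => ¬ c + 1 ≤ a) := by
        rw [Finset.mem_filter, Finset.mem_range]; omega
      rw [Finset.sum_eq_single_of_mem _ hmem (fun a _ hne => if_neg (fun e => hne e.symm)), if_pos rfl]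
    · rw [if_neg h1]
      exact Finset.sum_eq_zero fun a ha => by
        rw [Finset.mem_filter] at ha
        rw [if_neg (by omega)]
  linarith

/-- The weighted mean over `a ≥ c+1` is at most the mean: `Σ_{a ≥ c+1} a·M_C(a) ≤ Σ_{k<K, k∈C} h k`. [this work] -/
theorem sum_countMass_mul_le_mean_gen {h : ℕ → ℝ} (hh : ∀ k, k < K → 0 ≤ h k ∧ h k ≤ 1) (C : Finset ℕ) (c : ℕ) :
    ∑ a ∈ (range (K + 1)).filter (fun a => c + 1 ≤ a), (a : ℝ) * ∑ Q ∈ (range K).powerset, hairW K h Q * (if (Q ∩ C).card = a then (1 : ℝ) else 0) ≤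
      ∑ k ∈ (range K).filter (fun k => k ∈ C), h k := by
  rw [← sum_hairW_count_eq_mean h C K]
  calc ∑ a ∈ (range (K + 1)).filter (fun a => c + 1 ≤ a), (a : ℝ) * ∑ Q ∈ (range K).powerset, hairW K h Q * (if (Q ∩ C).card = a then (1 : ℝ) else 0)
      ≤ ∑ a ∈ range (K + 1), (a : ℝ) * ∑ Q ∈ (range K).powerset, hairW K h Q * (if (Q ∩ C).card = a then (1 : ℝ) else 0) :=
        Finset.sum_le_sum_of_subset_of_nonneg (Finset.filter_subset _ _) fun a _ _ =>
          mul_nonneg (Nat.cast_nonneg a) (Finset.sum_nonneg fun Q _ => mul_nonneg (hairW_nonneg hh Q) (by split_ifs <;> norm_num))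
    _ = ∑ Q ∈ (range K).powerset, hairW K h Q * ((Q ∩ C).card : ℝ) := by
        simp_rw [Finset.mul_sum]
        rw [Finset.sum_comm]
        refine Finset.sum_congr rfl fun Q hQ => ?_
        rw [Finset.mem_powerset] at hQ
        have ha : (Q ∩ C).card ∈ range (K + 1) := by
          rw [Finset.mem_range]
          have := (Finset.card_le_card (Finset.inter_subset_left (s₁ := Q) (s₂ := C))).trans ((Finset.card_le_card hQ).trans (Finset.card_range K).le)
          omega
        rw [Finset.sum_eq_single_of_mem _ ha (fun a _ hne => by rw [if_neg (Ne.symm hne)]; ring)]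
        rw [if_pos rfl]; ring

/-! ## Cauchy–Schwarz for the flank efficiency at layer `j` -/

/-- **Flank-efficiency lower bound at layer `j`.**  For nonnegative `p a`, `q b` and `A = {a ≤ n : j ≤ a}`:
`(Σ_{a∈A} p a)²(Σ_{b∈A} q b)² ≤ (Σ_{a,b∈A} p a q b/(a+b+1−2j)) · (φ·Σ_{a∈A}(a−j) p a + π·Σ_{b∈A}(b−j) q b + π φ)`
(`π = Σ_{a∈A} p a`, `φ = Σ_{b∈A} q b`; Sedrakyan's form of Cauchy–Schwarz with weights `p a q b` and values `a+b+1−2j ≥ 1`). [this work] -/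
theorem flank_sum_lower_bound_gen (n j : ℕ) (p q : ℕ → ℝ) (hp : ∀ a, 0 ≤ p a) (hq : ∀ b, 0 ≤ q b) :
    (∑ a ∈ (range (n + 1)).filter (fun a => j ≤ a), p a) ^ 2 * (∑ b ∈ (range (n + 1)).filter (fun b => j ≤ b), q b) ^ 2 ≤
      (∑ a ∈ (range (n + 1)).filter (fun a => j ≤ a), ∑ b ∈ (range (n + 1)).filter (fun b => j ≤ b), p a * q b / ((a : ℝ) + b + 1 - 2 * j)) *
      ((∑ b ∈ (range (n + 1)).filter (fun b => j ≤ b), q b) * (∑ a ∈ (range (n + 1)).filter (fun a => j ≤ a), ((a : ℝ) - j) * p a) +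
       (∑ a ∈ (range (n + 1)).filter (fun a => j ≤ a), p a) * (∑ b ∈ (range (n + 1)).filter (fun b => j ≤ b), ((b : ℝ) - j) * q b) +
       (∑ a ∈ (range (n + 1)).filter (fun a => j ≤ a), p a) * (∑ b ∈ (range (n + 1)).filter (fun b => j ≤ b), q b)) := by
  set A := (range (n + 1)).filter (fun a => j ≤ a) with hA
  have hApos : ∀ x ∈ A ×ˢ A, (0 : ℝ) < (x.1 : ℝ) + x.2 + 1 - 2 * j := by
    intro x hx
    rw [Finset.mem_product, hA, Finset.mem_filter, Finset.mem_filter] at hx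
    have h1 : (j : ℝ) ≤ x.1 := by exact_mod_cast hx.1.2
    have h2 : (j : ℝ) ≤ x.2 := by exact_mod_cast hx.2.2
    linarith
  have hcs := Finset.sum_sq_le_sum_mul_sum_of_sq_le_mul (A ×ˢ A)
    (f := fun x => p x.1 * q x.2 / ((x.1 : ℝ) + x.2 + 1 - 2 * j)) (g := fun x => p x.1 * q x.2 * ((x.1 : ℝ) + x.2 + 1 - 2 * j))
    (r := fun x => p x.1 * q x.2)
    (fun x hx => div_nonneg (mul_nonneg (hp _) (hq _)) (hApos x hx).le)
    (fun x hx => mul_nonneg (mul_nonneg (hp _) (hq _)) (hApos x hx).le)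
    (fun x hx => by
      have hpos := hApos x hx
      rw [div_mul_eq_mul_div, le_div_iff₀ hpos]
      nlinarith)
  have e1 : ∑ x ∈ A ×ˢ A, p x.1 * q x.2 = (∑ a ∈ A, p a) * (∑ b ∈ A, q b) := by
    rw [Finset.sum_product, Finset.sum_mul_sum]
  have e2 : ∑ x ∈ A ×ˢ A, p x.1 * q x.2 / ((x.1 : ℝ) + x.2 + 1 - 2 * j) = ∑ a ∈ A, ∑ b ∈ A, p a * q b / ((a : ℝ) + b + 1 - 2 * j) := by
    rw [Finset.sum_product]
  have e3 : ∑ x ∈ A ×ˢ A, p x.1 * q x.2 * ((x.1 : ℝ) + x.2 + 1 - 2 * j) =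
      (∑ b ∈ A, q b) * (∑ a ∈ A, ((a : ℝ) - j) * p a) + (∑ a ∈ A, p a) * (∑ b ∈ A, ((b : ℝ) - j) * q b) + (∑ a ∈ A, p a) * (∑ b ∈ A, q b) := by
    rw [Finset.sum_product]
    have : ∀ a ∈ A, ∑ b ∈ A, p a * q b * ((a : ℝ) + b + 1 - 2 * j) =
        (∑ b ∈ A, q b) * (((a : ℝ) - j) * p a) + p a * (∑ b ∈ A, ((b : ℝ) - j) * q b) + p a * (∑ b ∈ A, q b) := by
      intro a _
      rw [Finset.sum_mul, Finset.mul_sum, Finset.mul_sum, ← Finset.sum_add_distrib, ← Finset.sum_add_distrib]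
      exact Finset.sum_congr rfl fun b _ => by ring
    rw [Finset.sum_congr rfl this, Finset.sum_add_distrib, Finset.sum_add_distrib, ← Finset.mul_sum, ← Finset.sum_mul,
      ← Finset.sum_mul]
  rw [e1, e2, e3] at hcs
  have e4 : ((∑ a ∈ A, p a) * ∑ b ∈ A, q b) ^ 2 = (∑ a ∈ A, p a) ^ 2 * (∑ b ∈ A, q b) ^ 2 := by ring
  rw [e4] at hcs
  exact hcs

/-- **The algebra behind the sharp flank efficiency.**  From Cauchy–Schwarz `(π_L π_R)² ≤ X·(π_R m_L + π_L m_R + π_L π_R)` with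
`m_L ≤ S_L − j π_L`, `m_R ≤ S_R − j π_R`, `0 < ρ ≤ π_L, π_R`, `j ≤ S_L`, `j ≤ S_R`, `S_L + S_R ≤ S` and `X ≥ 0`:
`ρ³ ≤ X·(S − (2j−1)ρ)`. [this work] -/
theorem flank_algebra_gen {X πL πR mL mR SL SR S ρ j : ℝ} (hρ : 0 < ρ) (hX0 : 0 ≤ X) (hj : 1 ≤ j)
    (hcs : πL ^ 2 * πR ^ 2 ≤ X * (πR * mL + πL * mR + πL * πR))
    (hπL : ρ ≤ πL) (hπR : ρ ≤ πR) (hmL : mL ≤ SL - j * πL) (hmR : mR ≤ SR - j * πR)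
    (hSL : j ≤ SL) (hSR : j ≤ SR) (hS : SL + SR ≤ S) : ρ ^ 3 ≤ X * (S - (2 * j - 1) * ρ) := by
  have hπL0 : 0 < πL := lt_of_lt_of_le hρ hπL
  have hπR0 : 0 < πR := lt_of_lt_of_le hρ hπR
  -- `D ≤ π_R S_L + π_L S_R − (2j−1) π_L π_R`
  have hD : πR * mL + πL * mR + πL * πR ≤ πR * SL + πL * SR - (2 * j - 1) * (πL * πR) := by
    have t1 := mul_le_mul_of_nonneg_left hmL hπR0.le
    have t2 := mul_le_mul_of_nonneg_left hmR hπL0.le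
    nlinarith
  -- `ρ·(π_R S_L + π_L S_R − (2j−1)π_L π_R) ≤ π_L π_R (S_L + S_R − (2j−1)ρ)`
  have h2 : ρ * (πR * SL + πL * SR - (2 * j - 1) * (πL * πR)) ≤ πL * πR * (SL + SR - (2 * j - 1) * ρ) := by
    have hSL0 : 0 ≤ SL := le_trans (by linarith) hSL
    have hSR0 : 0 ≤ SR := le_trans (by linarith) hSR
    have t1 : ρ * (πR * SL) ≤ πL * πR * SL := by
      have := mul_le_mul_of_nonneg_right hπL (mul_nonneg hπR0.le hSL0)
      nlinarith
    have t2 : ρ * (πL * SR) ≤ πL * πR * SR := by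
      have := mul_le_mul_of_nonneg_right hπR (mul_nonneg hπL0.le hSR0)
      nlinarith
    nlinarith
  -- combine with Cauchy–Schwarz
  have h3 : ρ * (πL ^ 2 * πR ^ 2) ≤ X * (πL * πR) * (SL + SR - (2 * j - 1) * ρ) := by
    have t1 : ρ * (πL ^ 2 * πR ^ 2) ≤ ρ * (X * (πR * mL + πL * mR + πL * πR)) := mul_le_mul_of_nonneg_left hcs hρ.le
    have t2 : ρ * (X * (πR * mL + πL * mR + πL * πR)) ≤ ρ * (X * (πR * SL + πL * SR - (2 * j - 1) * (πL * πR))) :=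
      mul_le_mul_of_nonneg_left (mul_le_mul_of_nonneg_left hD hX0) hρ.le
    have t3 : ρ * (X * (πR * SL + πL * SR - (2 * j - 1) * (πL * πR))) = X * (ρ * (πR * SL + πL * SR - (2 * j - 1) * (πL * πR))) := by ring
    have t4 : X * (ρ * (πR * SL + πL * SR - (2 * j - 1) * (πL * πR))) ≤ X * (πL * πR * (SL + SR - (2 * j - 1) * ρ)) :=
      mul_le_mul_of_nonneg_left h2 hX0
    nlinarith
  -- divide by `π_L π_R > 0`
  have hππ : 0 < πL * πR := mul_pos hπL0 hπR0
  have h4 : ρ * (πL * πR) ≤ X * (SL + SR - (2 * j - 1) * ρ) := by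
    have e : ρ * (πL ^ 2 * πR ^ 2) = (ρ * (πL * πR)) * (πL * πR) := by ring
    have e' : X * (πL * πR) * (SL + SR - (2 * j - 1) * ρ) = (X * (SL + SR - (2 * j - 1) * ρ)) * (πL * πR) := by ring
    rw [e, e'] at h3
    exact le_of_mul_le_mul_right h3 hππ
  have h5 : ρ ^ 3 ≤ ρ * (πL * πR) := by
    have : ρ * ρ ≤ πL * πR := mul_le_mul hπL hπR hρ.le hπL0.le
    nlinarith
  have h6 : X * (SL + SR - (2 * j - 1) * ρ) ≤ X * (S - (2 * j - 1) * ρ) := mul_le_mul_of_nonneg_left (by linarith) hX0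
  linarith

end Summit.CriticalPhenomena.PercolationContinuityZ3.Theorems.HairyCycle

end
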